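import Mathlib.Analysis.Polynomial.Basic
import Mathlib.Algebra.Polynomial.Expand
import Mathlib.Topology.Order.Compact
import Literature.Analysis.TotalPositivity.ExpPolySolidMinorsPos
import Literature.Analysis.TotalPositivity.MultiplyPositiveProofs
import HarnessLib

/-!
# `e^{Rz} Q(z) ∈ PF_m` and `cosh(R√z) Q(z) ∈ PF_m` for `R ≥ R₀(m, Q)` — `Q > 0` on `[0, ∞)`

Trunk T-ANALYSIS (Literature/Analysis/TotalPositivity). The polynomial-factor case of Katkova's
Theorem 3 [Katkova2006, Thm. 3: `e^{nz} ξ₁(z), cosh(n√z) ξ₁(z) ∈ PF_m` for `n ≥ n₀(m)`] in the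
form used by the tree's proof (`XiMultiplePositivityExpFactorsProofs.lean`): for a real polynomial
`Q` with `Q(x) > 0` for all `x ≥ 0` and every `m`,

* `isMultiplyPositiveSeq_conv_exp_poly` — the coefficient sequence
  `conv (R^k/k!)_k (Q.coeff k)_k` of `e^{Rz} Q(z)` is `m`-times positive for all `R ≥ R₀(m, Q)`;
* `isMultiplyPositiveSeq_conv_cosh_poly` — so is `conv (R^{2k}/(2k)!)_k (Q.coeff k)_k`, the
  coefficient sequence of `cosh(R√z) Q(z)`: it is the even-indexed subsequence of that of
  `e^{Rw} Q(w²)` [Katkova2006, §2: "the matrix of coefficients of `cosh √z` is the submatrix of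
  the matrix of coefficients of `e^z`"].

Inputs: `isMultiplyPositiveSeq_expPolySeq` (`ExpPolySolidMinorsPos.lean`) for `e^w Q(w/R)`, the
lower bound `Q(x) ≥ c₀ (1+x)^{deg Q}` on `[0,∞)` (`exists_lower_bound_poly`, compactness + leading
term), the rescaling `k ↦ R^k a_k` of `PF_m` sequences (`IsMultiplyPositiveSeq.mul_pow`) and the
passage to even-indexed subsequences (`IsMultiplyPositiveSeq.subseq_even`).

## References

* O. M. Katkova, *Multiple positivity and the Riemann zeta-function*, CMFT 7 (2007) 13–31;
  arXiv:math/0505174, Thm. 3 and §2 (Thm. 3″). [Katkova2006]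
* A. Edrei, *Proof of a conjecture of Schoenberg on the generating function of a totally
  positive sequence*, Canad. J. Math. 5 (1953) 86–94, §4. [Edrei1953]
-/

noncomputable section

open Finset Polynomial Filter
open scoped Nat Topology

namespace Literature.Analysis.TotalPositivity

/-! ### Rescaling and even subsequences of `PF_m` sequences -/

/-- **`PF_m` is invariant under `a_k ↦ t^k a_k`, `t > 0`**: the minor on rows `r`, columns `c`
gets multiplied by `∏ t^{r_i} · ∏ t^{-c_j} > 0`. [Karlin1968, Ch. 8 §1] [folklore] -/
theorem IsMultiplyPositiveSeq.mul_pow {m : ℕ} {a : ℕ → ℝ} (h : IsMultiplyPositiveSeq m a)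
    {t : ℝ} (ht : 0 < t) : IsMultiplyPositiveSeq m (fun k => t ^ k * a k) := by
  intro n hn r c hr hc
  have key : (Matrix.of fun i j : Fin n => seqZ (fun k => t ^ k * a k) ((r i : ℤ) - c j)) =
      Matrix.of (fun i j : Fin n => (fun i => t ^ r i) i *
        (Matrix.of fun i j : Fin n => (fun j => t⁻¹ ^ c j) j *
          (Matrix.of fun i j : Fin n => seqZ a ((r i : ℤ) - c j)) i j) i j) := by
    ext i j
    simp only [Matrix.of_apply]
    unfold seqZ
    split_ifs with hle
    · have hrc : c j ≤ r i := by omega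
      have htn : ((r i : ℤ) - c j).toNat = r i - c j := by omega
      rw [htn]
      show t ^ (r i - c j) * a (r i - c j) = t ^ r i * (t⁻¹ ^ c j * a (r i - c j))
      rw [pow_sub₀ t ht.ne' hrc, inv_pow]
      ring
    · ring
  unfold toeplitzMinor
  rw [key, Matrix.det_mul_column, Matrix.det_mul_row]
  exact mul_nonneg (prod_nonneg fun i _ => by positivity)
    (mul_nonneg (prod_nonneg fun j _ => by positivity) (h n hn r c hr hc))

/-- **The even-indexed subsequence of a `PF_m` sequence is `PF_m`**: the Toeplitz matrix of
`(a₂ₖ)` is the submatrix of `(a_{i-j})` on even rows and columns. [Edrei1953, §4;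
Katkova2006, §2 ("cosh √z ∈ SPF_∞")] [cite: Katkova2006, §2] -/
theorem IsMultiplyPositiveSeq.subseq_even {m : ℕ} {a : ℕ → ℝ} (h : IsMultiplyPositiveSeq m a) :
    IsMultiplyPositiveSeq m fun k => a (2 * k) := by
  intro n hn r c hr hc
  have hmin : toeplitzMinor (fun k => a (2 * k)) r c =
      toeplitzMinor a (fun i => 2 * r i) (fun j => 2 * c j) := by
    unfold toeplitzMinor
    congr 1
    ext i j
    simp only [Matrix.of_apply, seqZ]
    push_cast
    by_cases hij : c j ≤ r i
    · have h1 : (0 : ℤ) ≤ (r i : ℤ) - c j := by omega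
      have h2 : (0 : ℤ) ≤ 2 * (r i : ℤ) - 2 * c j := by omega
      rw [if_pos h1, if_pos h2]
      congr 1
      omega
    · have h1 : ¬ (0 : ℤ) ≤ (r i : ℤ) - c j := by omega
      have h2 : ¬ (0 : ℤ) ≤ 2 * (r i : ℤ) - 2 * c j := by omega
      rw [if_neg h1, if_neg h2]
  rw [hmin]
  exact h n hn (fun i => 2 * r i) (fun j => 2 * c j)
    (fun i j hij => by show 2 * r i < 2 * r j; have := hr hij; omega)
    (fun i j hij => by show 2 * c i < 2 * c j; have := hc hij; omega)

/-! ### A positive polynomial dominates `c₀ (1+x)^{deg}` on `[0, ∞)` -/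

/-- If `P(x) = Σ_{j ≤ r} p_j x^j > 0` on `[0,∞)` and `p_r > 0` then `P(x) ≥ c₀ (1+x)^r` there for
some `c₀ > 0` (the leading term dominates for large `x`, compactness on the rest). [folklore] -/
theorem exists_lower_bound_poly (p : ℕ → ℝ) (r : ℕ) (hr : 0 < p r)
    (hpos : ∀ x : ℝ, 0 ≤ x → 0 < ∑ j ∈ range (r + 1), p j * x ^ j) :
    ∃ c₀ : ℝ, 0 < c₀ ∧ ∀ x : ℝ, 0 ≤ x → c₀ * (1 + x) ^ r ≤ ∑ j ∈ range (r + 1), p j * x ^ j := by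
  rcases Nat.eq_zero_or_pos r with rfl | hr0
  · refine ⟨p 0, hr, fun x _ => by simp⟩
  set A : ℝ := ∑ j ∈ range r, |p j| with hA
  have hA0 : 0 ≤ A := Finset.sum_nonneg fun j _ => abs_nonneg _
  set X₁ : ℝ := max 1 (2 * A / p r) with hX₁
  have hX1 : 1 ≤ X₁ := le_max_left _ _
  -- the tail
  have htail : ∀ x : ℝ, X₁ ≤ x → p r / 2 ^ (r + 1) * (1 + x) ^ r ≤ ∑ j ∈ range (r + 1), p j * x ^ j := by
    intro x hx
    have hx1 : 1 ≤ x := le_trans hX1 hx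
    have hx0 : 0 ≤ x := le_trans zero_le_one hx1
    have hAx : A ≤ p r / 2 * x := by
      have h1 : 2 * A / p r ≤ x := le_trans (le_max_right _ _) hx
      rw [div_le_iff₀ hr] at h1
      linarith
    rw [Finset.sum_range_succ]
    have hlow : |∑ j ∈ range r, p j * x ^ j| ≤ A * x ^ (r - 1) := by
      refine (Finset.abs_sum_le_sum_abs _ _).trans ?_
      rw [hA, Finset.sum_mul]
      refine Finset.sum_le_sum fun j hj => ?_
      rw [mem_range] at hj
      rw [abs_mul, abs_pow, abs_of_nonneg hx0]
      exact mul_le_mul_of_nonneg_left (pow_le_pow_right₀ hx1 (by omega)) (abs_nonneg _)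
    have hxr : x ^ (r - 1) * x = x ^ r := pow_sub_one_mul (by omega) x
    have h2 : A * x ^ (r - 1) ≤ p r / 2 * x ^ r := by
      rw [← hxr]
      have : 0 ≤ x ^ (r - 1) := pow_nonneg hx0 _
      nlinarith
    have h3 : (1 + x) ^ r ≤ 2 ^ r * x ^ r := by
      rw [← mul_pow]
      exact pow_le_pow_left₀ (by linarith) (by linarith) _
    have h4 : p r / 2 ^ (r + 1) * (1 + x) ^ r ≤ p r / 2 * x ^ r := by
      rw [pow_succ]
      have : 0 < (2 : ℝ) ^ r := by positivity
      calc p r / (2 ^ r * 2) * (1 + x) ^ r ≤ p r / (2 ^ r * 2) * (2 ^ r * x ^ r) :=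
            mul_le_mul_of_nonneg_left h3 (by positivity)
        _ = p r / 2 * x ^ r := by field_simp
    have h5 := neg_abs_le (∑ j ∈ range r, p j * x ^ j)
    linarith
  -- the head, by compactness
  have hcont : Continuous fun x : ℝ => ∑ j ∈ range (r + 1), p j * x ^ j :=
    continuous_finsetSum _ fun j _ => continuous_const.mul (continuous_pow j)
  obtain ⟨x₀, hx₀, hmin⟩ := (isCompact_Icc : IsCompact (Set.Icc (0 : ℝ) X₁)).exists_isMinOn
    ⟨0, Set.left_mem_Icc.2 (le_trans zero_le_one hX1)⟩ hcont.continuousOn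
  set δ₀ : ℝ := ∑ j ∈ range (r + 1), p j * x₀ ^ j with hδ₀
  have hδ₀pos : 0 < δ₀ := hpos x₀ hx₀.1
  have hX0 : 0 < 1 + X₁ := by linarith
  refine ⟨min (p r / 2 ^ (r + 1)) (δ₀ / (1 + X₁) ^ r), lt_min (by positivity) (by positivity),
    fun x hx => ?_⟩
  rcases le_or_gt x X₁ with hle | hgt
  · have h1 : δ₀ ≤ ∑ j ∈ range (r + 1), p j * x ^ j := hmin ⟨hx, hle⟩
    have h2 : (1 + x) ^ r ≤ (1 + X₁) ^ r := pow_le_pow_left₀ (by linarith) (by linarith) _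
    calc min (p r / 2 ^ (r + 1)) (δ₀ / (1 + X₁) ^ r) * (1 + x) ^ r
        ≤ δ₀ / (1 + X₁) ^ r * (1 + X₁) ^ r :=
          mul_le_mul (min_le_right _ _) h2 (by positivity) (by positivity)
      _ = δ₀ := by field_simp
      _ ≤ _ := h1
  · calc min (p r / 2 ^ (r + 1)) (δ₀ / (1 + X₁) ^ r) * (1 + x) ^ r
        ≤ p r / 2 ^ (r + 1) * (1 + x) ^ r :=
          mul_le_mul_of_nonneg_right (min_le_left _ _) (by positivity)
      _ ≤ _ := htail x hgt.le

/-- A real polynomial which is positive on `[0, ∞)` has positive leading coefficient. [folklore] -/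
theorem leadingCoeff_pos_of_eval_pos {Q : ℝ[X]} (hQ : ∀ x : ℝ, 0 ≤ x → 0 < Q.eval x) :
    0 < Q.leadingCoeff := by
  by_cases hdeg : Q.natDegree = 0
  · rw [Polynomial.leadingCoeff, hdeg, Polynomial.coeff_zero_eq_eval_zero]
    exact hQ 0 le_rfl
  · by_contra hle
    push Not at hle
    have hdeg' : 0 < Q.degree := by
      rw [Polynomial.degree_eq_natDegree (fun h0 => hdeg (by simp [h0]))]
      exact_mod_cast Nat.pos_of_ne_zero hdeg
    have htend := Q.tendsto_atBot_of_leadingCoeff_nonpos hdeg' hle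
    have hev : ∀ᶠ x : ℝ in atTop, Q.eval x ≤ 0 ∧ 0 ≤ x :=
      (htend.eventually (eventually_le_atBot 0)).and (eventually_ge_atTop 0)
    obtain ⟨x, hx1, hx2⟩ := hev.exists
    exact absurd (hQ x hx2) (not_lt.2 hx1)

/-! ### `e^{Rz} Q(z)`: the coefficient sequence -/

/-- For `R > 0`: `conv (R^k/k!) (Q.coeff) (N) = R^N · expPolySeq (Q.coeff) (deg Q) R N`, i.e.
`Σ_{i+j=N} R^i/i! q_j = R^N Σ_{j ≤ deg Q} q_j R^{-j} invFact (N - j)`. [folklore] -/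
theorem conv_expSeq_coeff_eq (Q : ℝ[X]) {R : ℝ} (hR : 0 < R) (N : ℕ) :
    conv (fun k => R ^ k / (k.factorial : ℝ)) (fun k => Q.coeff k) N =
      R ^ N * expPolySeq (fun j => Q.coeff j) Q.natDegree R N := by
  set d := Q.natDegree with hd
  -- both sides as a sum over `j < N + d + 1`
  have hL : conv (fun k => R ^ k / (k.factorial : ℝ)) (fun k => Q.coeff k) N =
      ∑ j ∈ range (N + d + 1), R ^ N * (Q.coeff j * R⁻¹ ^ j * invFact ((N : ℤ) - j)) := by
    unfold conv
    rw [← Finset.Nat.sum_antidiagonal_swap, Finset.Nat.sum_antidiagonal_eq_sum_range_succ_mk]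
    simp only [Prod.swap_prod_mk]
    have hsub : range N.succ ⊆ range (N + d + 1) := by
      intro j hj
      simp only [mem_range] at hj ⊢
      omega
    rw [← Finset.sum_subset hsub]
    · refine Finset.sum_congr rfl fun j hj => ?_
      rw [mem_range, Nat.lt_succ_iff] at hj
      have hcast : ((N : ℤ) - j) = ((N - j : ℕ) : ℤ) := by push_cast [hj]; ring
      rw [hcast, invFact_natCast, pow_sub₀ R hR.ne' hj, inv_pow]
      field_simp
    · intro j _ hj
      rw [mem_range, Nat.lt_succ_iff, not_le] at hj
      rw [invFact_of_neg (by omega), mul_zero, mul_zero]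
  have hRt : R ^ N * expPolySeq (fun j => Q.coeff j) d R N =
      ∑ j ∈ range (N + d + 1), R ^ N * (Q.coeff j * R⁻¹ ^ j * invFact ((N : ℤ) - j)) := by
    unfold expPolySeq
    rw [Finset.mul_sum]
    have hsub : range (d + 1) ⊆ range (N + d + 1) := by
      intro j hj
      simp only [mem_range] at hj ⊢
      omega
    rw [← Finset.sum_subset hsub]
    intro j _ hj
    rw [mem_range, Nat.lt_succ_iff, not_le] at hj
    rw [Polynomial.coeff_eq_zero_of_natDegree_lt hj]
    simp
  rw [hL, hRt]

/-- **`e^{Rz} Q(z) ∈ PF_m` for `R ≥ R₀(m, Q)`** when the real polynomial `Q` is positive on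
`[0, ∞)`: the coefficient sequence `conv (R^k/k!)_k (q_k)_k` is `m`-times positive. (For `Q`
with all zeros in `|arg(-z)| ≤ π/(m+1)` this holds for every `R ≥ 0` by Schoenberg's Theorem B;
the point is that `R` large compensates finitely many zeros anywhere off `[0, ∞)`.)
[cite: Katkova2006, Thm. 3 (i) (Thm. 3″, f²_ε)] -/
theorem isMultiplyPositiveSeq_conv_exp_poly (Q : ℝ[X]) (hQ : ∀ x : ℝ, 0 ≤ x → 0 < Q.eval x)
    (m : ℕ) : ∃ R₀ : ℝ, ∀ R : ℝ, R₀ ≤ R →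
      IsMultiplyPositiveSeq m (conv (fun k => R ^ k / (k.factorial : ℝ)) (fun k => Q.coeff k)) := by
  set r := Q.natDegree with hr
  set p : ℕ → ℝ := fun j => Q.coeff j with hp
  have hPr : 0 < p r := leadingCoeff_pos_of_eval_pos hQ
  have hsum : ∀ x : ℝ, ∑ j ∈ range (r + 1), p j * x ^ j = Q.eval x := fun x =>
    (Polynomial.eval_eq_sum_range x).symm
  obtain ⟨c₀, hc₀, hP⟩ := exists_lower_bound_poly p r hPr (fun x hx => by rw [hsum]; exact hQ x hx)
  obtain ⟨R₁, hR₁⟩ := isMultiplyPositiveSeq_expPolySeq p r hc₀ hP m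
  refine ⟨max R₁ 1, fun R hR => ?_⟩
  have hR0 : 0 < R := lt_of_lt_of_le one_pos (le_trans (le_max_right _ _) hR)
  have hpf := (hR₁ R (le_trans (le_max_left _ _) hR)).mul_pow hR0
  have heq : conv (fun k => R ^ k / (k.factorial : ℝ)) (fun k => Q.coeff k) =
      fun N => R ^ N * expPolySeq p r R N := funext fun N => conv_expSeq_coeff_eq Q hR0 N
  rw [heq]
  exact hpf

/-! ### `cosh(R√z) Q(z)`: even subsequence of `e^{Rw} Q(w²)` -/

/-- The coefficient sequence of `cosh(R√z) Q(z)` is the even-indexed subsequence of that of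
`e^{Rw} Q(w²)` (`Q(w²) = expand ℝ 2 Q`). [folklore] -/
theorem conv_expSeq_expand_two (Q : ℝ[X]) (R : ℝ) (K : ℕ) :
    conv (fun k => R ^ k / (k.factorial : ℝ)) (fun k => (expand ℝ 2 Q).coeff k) (2 * K) =
      conv (fun k => R ^ (2 * k) / ((2 * k).factorial : ℝ)) (fun k => Q.coeff k) K := by
  unfold conv
  simp only [Polynomial.coeff_expand (by norm_num : 0 < 2)]
  rw [show (∑ x ∈ antidiagonal (2 * K), R ^ x.1 / (x.1.factorial : ℝ) *
      (if 2 ∣ x.2 then Q.coeff (x.2 / 2) else 0)) =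
      ∑ x ∈ antidiagonal (2 * K), (if 2 ∣ x.2 then R ^ x.1 / (x.1.factorial : ℝ) * Q.coeff (x.2 / 2)
        else 0) from Finset.sum_congr rfl fun x _ => by split_ifs <;> simp,
    ← Finset.sum_filter]
  symm
  refine Finset.sum_nbij' (fun q => (2 * q.1, 2 * q.2)) (fun x => (x.1 / 2, x.2 / 2)) ?_ ?_ ?_ ?_ ?_
  · intro q hq
    rw [Finset.HasAntidiagonal.mem_antidiagonal] at hq
    simp only [Finset.mem_filter, Finset.HasAntidiagonal.mem_antidiagonal]
    exact ⟨by omega, dvd_mul_right 2 _⟩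
  · intro x hx
    simp only [Finset.mem_filter, Finset.HasAntidiagonal.mem_antidiagonal] at hx
    obtain ⟨h1, h2⟩ := hx
    rw [Finset.HasAntidiagonal.mem_antidiagonal]
    rw [Nat.dvd_iff_mod_eq_zero] at h2
    omega
  · intro q _
    simp
  · intro x hx
    simp only [Finset.mem_filter, Finset.HasAntidiagonal.mem_antidiagonal] at hx
    obtain ⟨h1, h2⟩ := hx
    rw [Nat.dvd_iff_mod_eq_zero] at h2
    ext <;> simp <;> omega
  · intro q _
    simp

/-- **`cosh(R√z) Q(z) ∈ PF_m` for `R ≥ R₀(m, Q)`** when the real polynomial `Q` is positive on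
`[0, ∞)`: the coefficient sequence `conv (R^{2k}/(2k)!)_k (q_k)_k` is `m`-times positive. Proof:
`Q(w²) > 0` on `[0, ∞)`, so `e^{Rw} Q(w²) ∈ PF_m` for `R` large
(`isMultiplyPositiveSeq_conv_exp_poly`), and the even-indexed subsequence of a `PF_m` sequence is
`PF_m`. [cite: Katkova2006, Thm. 3 (ii) (Thm. 3″, f³_ε)] -/
theorem isMultiplyPositiveSeq_conv_cosh_poly (Q : ℝ[X]) (hQ : ∀ x : ℝ, 0 ≤ x → 0 < Q.eval x)
    (m : ℕ) : ∃ R₀ : ℝ, ∀ R : ℝ, R₀ ≤ R →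
      IsMultiplyPositiveSeq m
        (conv (fun k => R ^ (2 * k) / ((2 * k).factorial : ℝ)) (fun k => Q.coeff k)) := by
  have hQ₂ : ∀ x : ℝ, 0 ≤ x → 0 < (expand ℝ 2 Q).eval x := fun x _ => by
    rw [Polynomial.expand_eval]
    exact hQ _ (sq_nonneg x)
  obtain ⟨R₀, hR₀⟩ := isMultiplyPositiveSeq_conv_exp_poly (expand ℝ 2 Q) hQ₂ m
  refine ⟨R₀, fun R hR => ?_⟩
  have h := (hR₀ R hR).subseq_even
  have heq : (fun K => conv (fun k => R ^ k / (k.factorial : ℝ)) (fun k => (expand ℝ 2 Q).coeff k)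
      (2 * K)) = conv (fun k => R ^ (2 * k) / ((2 * k).factorial : ℝ)) (fun k => Q.coeff k) :=
    funext fun K => conv_expSeq_expand_two Q R K
  rw [heq] at h
  exact h

end Literature.Analysis.TotalPositivity
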